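import Summits.ResolutionOfSingularities.ResolutionOfSingularities.Theorems.FrobeniusLadderFInjectiveMacaulayficationX2QuarticPointFloor
import Summits.ResolutionOfSingularities.ResolutionOfSingularities.Theorems.FrobeniusLadderFInjectiveMacaulayficationX2CubicFormFSideChar2
import HarnessLib

/-!
# THE p = 3 QUARTIC F-SIDE CLASS ROW: for a quartic form `F₄ ∈ (Y₀³,…,Y₃³)` with `x² + F₄` prime, isolated, and pointwise-smooth dehomogenisations, the vertex is NOT F-pure in
# characteristic 3 and the POINT FLOOR IS THE CURE (one storey) — census pair `¬ FullCl 3 (𝒪_{Y,v}) ∧ FInjectivizationGermAt 3 v`; member: the Fermat quartic `z² + x⁴ + y⁴ + u⁴ + t⁴`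
# over every field of characteristic 3
# (crux `FInjectiveMacaulayfication` stmt-ResolutionOfSingularities-15315, chain w45a; this seat's TAKING line 01:30Z (β″), the odd-p analogue of RULING R22.15; seat res-L1-w45a-stub-1 g14;
# sequel of ✓ `…X2QuarticPointFloor` (floor FULL for every odd `p`))

[OURS · L1 W4.5a] Support file (`--supports stmt-ResolutionOfSingularities-15315 --as helper`); def-free; UNCONDITIONAL; no named fact; NOT a statement of any manuscript. HONEST BILLING:
an F-side class row of the SIMPLEST kind (cure = the point floor, one storey, no composite centre), `p = 3`; evidence for nothing about beds needing composite centres; nothing of the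
crux is proved. AI-written (AI review is weaker than expert review).

* §3 (`p = 3`) `mem_span_pow_of_support`, ★ `vertex_not_fullCl_quartic_char3` (`F₄ ∈ (Yᵢ³)` ⇒ `f² = X₄·X₄³ + (2X₄² + F)·F ∈ 𝔪^{[3]}`), ★★ `fSide_classRow_quartic_char3` (¬FullCl 3 (𝒪_{Y,v}) ∧
  SCOPE ∧ LEGAL-and-FULL point floor) and `quartic_bad_germ_row_char3` (census pair).
* §4 THE FERMAT QUARTIC at `p = 3` over ANY field of characteristic 3: `fermat4_isHomogeneous`, `fermat4_support_cube`, `fermat4_f_eq`, `prime_fermatQuartic_char3` (Eisenstein at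
  `(1,1,1,0)`: `1+1+1 = 0`, `∂s/∂x = 4 = 1`), `dehomogenisation_fermat4`, `smooth_fermat4_chart` (`4Z_b³`), ★ `fermatQuartic_fSide_row_char3`, `fermatQuartic_bad_germ_row_char3`
  (`hoff` from this seat's ✓ `BrieskornPhamSpecimen`, `c = 2`, `a_j = 4`).
WHY (4, 3): for `p ≥ 5` the vertex of `x² + F₄` is F-pure (T-side input, lead-1's habitat #3a), and for forms of degree `≥ 5` the floor charts `X₄² + X_a^{d−2}W` are NOT F-pure along `E`
(two-term certificate `(2, d−2 ≥ 3)`), so (quartic, `p = 3`) is the odd-`p` habitat of one-storey point-floor cures of double points.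
[folklore mathematics, OURS as a certificate; cite: Fedder1983, Prop. 1.7 and Thm. 1.12; GortzWedhorn2020, Prop. 13.91 (2)]
-/

-- single-problem summit: the doubled namespace component is forced
set_option linter.dupNamespace false

noncomputable section

namespace Summit.ResolutionOfSingularities.ResolutionOfSingularities.Theorems.FInjectiveMacaulayfication.X2QuarticFSideChar3

open CategoryTheory CategoryTheory.Limits AlgebraicGeometry TopologicalSpace IsLocalRing MvPolynomial
open Literature.AlgebraicGeometry.Resolution
open Summit.ResolutionOfSingularities.ResolutionOfSingularities.Theorems.FInjectiveMacaulayfication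
open SliceableCentre GermForm GermOfGlobalBlowup X2FormPointFloor X2QuarticPointFloor

variable (k : Type) [Field k]

/-! ## §3 `p = 3`: the vertex is not F-pure when `F₄ ∈ (Yᵢ³)`; the class row -/

/-- A polynomial all of whose monomials contain an `e`-th power of some variable lies in `(Y₀^e, …, Y_{m−1}^e)`. [elementary] -/
theorem mem_span_pow_of_support {m : ℕ} (e : ℕ) (F : MvPolynomial (Fin m) k) (hpow : ∀ d ∈ F.support, ∃ i, e ≤ d i) :
    F ∈ Ideal.span (Set.range fun i : Fin m => (X i : MvPolynomial (Fin m) k) ^ e) := by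
  classical
  rw [F.as_sum]
  refine Ideal.sum_mem _ fun d hd => ?_
  obtain ⟨i, hi⟩ := hpow d hd
  have hle : Finsupp.single i e ≤ d := Finsupp.single_le_iff.mpr hi
  have eq : monomial d (coeff d F) = (X i : MvPolynomial (Fin m) k) ^ e * monomial (d - Finsupp.single i e) (coeff d F) := by
    rw [X_pow_eq_monomial, monomial_mul, one_mul, add_tsub_cancel_of_le hle]
  rw [eq]
  exact Ideal.mul_mem_right _ _ (Ideal.subset_span ⟨i, rfl⟩)

/-- ★ **THE VERTEX OF `x² + F₄` IS NOT F-PURE IN CHARACTERISTIC 3** when every monomial of `F₄` contains a cube (`F₄ ∈ (Y₀³,…,Y₃³)`; the Fermat quartic is such):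
`f² = X₄·X₄³ + (2X₄² + F)·F ∈ 𝔪^{[3]}` — Fedder at the vertex. [folklore; cite: Fedder1983, Prop. 1.7 and Thm. 1.12] -/
theorem vertex_not_fullCl_quartic_char3 [CharP k 3] (F : MvPolynomial (Fin 4) k) (hF : F.IsHomogeneous 4) (hcu : ∀ d ∈ F.support, ∃ i, 3 ≤ d i)
    (f : MvPolynomial (Fin 5) k) (hf : f = X 4 ^ 2 + rename (Fin.castSucc : Fin 4 → Fin 5) F) (hprime : Prime f)
    (v : Spec (.of (MvPolynomial (Fin 5) k ⧸ Ideal.span {f})))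
    (hv : v.asIdeal = Ideal.span (Set.range fun j : Fin 5 => Ideal.Quotient.mk (Ideal.span {f}) (X j))) :
    ¬ FullCl 3 ((Spec (.of (MvPolynomial (Fin 5) k ⧸ Ideal.span {f}))).presheaf.stalk v) := by
  haveI : Fact (Nat.Prime 3) := ⟨Nat.prime_three⟩
  refine HypersurfaceOriginNotFull.not_fullCl_stalk_origin_of_fedder_mem 3 k f hprime.ne_zero (constantCoeff_f_deg k 4 (by norm_num) F hF f hf) ?_ v hv
  have hF' : rename (Fin.castSucc : Fin 4 → Fin 5) F ∈ Ideal.span (Set.range fun j : Fin 5 => (X j : MvPolynomial (Fin 5) k) ^ 3) := by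
    have h := Ideal.mem_map_of_mem (rename (Fin.castSucc : Fin 4 → Fin 5)).toRingHom (mem_span_pow_of_support k 3 F hcu)
    rw [Ideal.map_span] at h
    refine (Ideal.span_le.mpr ?_) h
    rintro _ ⟨_, ⟨i, rfl⟩, rfl⟩
    exact Ideal.subset_span ⟨Fin.castSucc i, by simp [rename_X]⟩
  have e2 : f ^ (3 - 1) = X 4 * X 4 ^ 3 + (2 * X 4 ^ 2 + rename (Fin.castSucc : Fin 4 → Fin 5) F) * rename (Fin.castSucc : Fin 4 → Fin 5) F := by
    rw [show (3 - 1 : ℕ) = 2 from rfl, hf]; ring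
  rw [e2]
  exact Ideal.add_mem _ (Ideal.mul_mem_left _ _ (Ideal.subset_span ⟨4, rfl⟩)) (Ideal.mul_mem_left _ _ hF')

/-- ★★ **THE p = 3 QUARTIC F-SIDE CLASS ROW.** `char k = 3`; `F₄` a quartic form with every monomial containing a cube; `f = X₄² + F₄` prime; `Y` regular off the vertex `v`; the four
dehomogenisations of `F₄` with pointwise-smooth zero locus. Then: (NOT FULL) `𝒪_{Y,v}` is not `FullCl 3`; (SCOPE) `v` closed, singular, `dim 𝒪_{Y,v} = 4`; and for EVERY blowing up of
`Spec 𝒪_{Y,v}` along the point floor: LEGAL ∧ `FullCl 3` at every stalk — the point floor itself is the one-storey cure. [OURS · unconditional F-side class row of the simplest kind;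
cite: Fedder1983, Thm. 1.12; GortzWedhorn2020, Prop. 13.91 (2)] -/
theorem fSide_classRow_quartic_char3 [CharP k 3] (F : MvPolynomial (Fin 4) k) (hF : F.IsHomogeneous 4) (hcu : ∀ d ∈ F.support, ∃ i, 3 ≤ d i)
    (f : MvPolynomial (Fin 5) k) (hf : f = X 4 ^ 2 + rename (Fin.castSucc : Fin 4 → Fin 5) F) (hprime : Prime f)
    (hoff : ∀ (P : Ideal (MvPolynomial (Fin 5) k ⧸ Ideal.span {f})) [P.IsPrime],
      ¬ Ideal.span (Set.range fun j : Fin 5 => Ideal.Quotient.mk (Ideal.span {f}) (X j)) ≤ P → IsRegularLocalRing (Localization.AtPrime P))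
    (hws : ∀ (a : Fin 4) (Q : Ideal (MvPolynomial (Fin 3) k)), Q.IsPrime →
      MvPolynomial.aeval ((![![1, X 0, X 1, X 2], ![X 0, 1, X 1, X 2], ![X 0, X 1, 1, X 2], ![X 0, X 1, X 2, 1]] : Fin 4 → Fin 4 → MvPolynomial (Fin 3) k) a) F ∈ Q →
      ∃ D : Derivation k (MvPolynomial (Fin 3) k) (MvPolynomial (Fin 3) k),
        D (MvPolynomial.aeval ((![![1, X 0, X 1, X 2], ![X 0, 1, X 1, X 2], ![X 0, X 1, 1, X 2], ![X 0, X 1, X 2, 1]] : Fin 4 → Fin 4 → MvPolynomial (Fin 3) k) a) F) ∉ Q)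
    (v : Spec (.of (MvPolynomial (Fin 5) k ⧸ Ideal.span {f})))
    (hv : v.asIdeal = Ideal.span (Set.range fun j : Fin 5 => Ideal.Quotient.mk (Ideal.span {f}) (X j))) :
    ¬ FullCl 3 ((Spec (.of (MvPolynomial (Fin 5) k ⧸ Ideal.span {f}))).presheaf.stalk v) ∧
    (IsClosed ({v} : Set (Spec (.of (MvPolynomial (Fin 5) k ⧸ Ideal.span {f})))) ∧
      v ∉ Scheme.regularLocus (Spec (.of (MvPolynomial (Fin 5) k ⧸ Ideal.span {f}))) ∧
      ringKrullDim ((Spec (.of (MvPolynomial (Fin 5) k ⧸ Ideal.span {f}))).presheaf.stalk v) = (4 : ℕ)) ∧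
    (∀ (S' : Scheme.{0}) (g : S' ⟶ Spec ((Spec (.of (MvPolynomial (Fin 5) k ⧸ Ideal.span {f}))).presheaf.stalk v)),
      IsBlowup g ((affineBlowup.idealSheaf (Ideal.span (Set.range (fun j : Fin 5 => Ideal.Quotient.mk (Ideal.span {f}) (X j))))).comap
        ((Spec (.of (MvPolynomial (Fin 5) k ⧸ Ideal.span {f}))).fromSpecStalk v)) →
      (((affineBlowup.idealSheaf (Ideal.span (Set.range (fun j : Fin 5 => Ideal.Quotient.mk (Ideal.span {f}) (X j))))).comap
          ((Spec (.of (MvPolynomial (Fin 5) k ⧸ Ideal.span {f}))).fromSpecStalk v)) ≠ ⊥ ∧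
        (((((affineBlowup.idealSheaf (Ideal.span (Set.range (fun j : Fin 5 => Ideal.Quotient.mk (Ideal.span {f}) (X j))))).comap
            ((Spec (.of (MvPolynomial (Fin 5) k ⧸ Ideal.span {f}))).fromSpecStalk v))).support :
              Set (Spec ((Spec (.of (MvPolynomial (Fin 5) k ⧸ Ideal.span {f}))).presheaf.stalk v))) ⊆
            (Scheme.regularLocus (Spec ((Spec (.of (MvPolynomial (Fin 5) k ⧸ Ideal.span {f}))).presheaf.stalk v)))ᶜ) ∧
        (∀ s : S', g.base s ≠ closedPoint ((Spec (.of (MvPolynomial (Fin 5) k ⧸ Ideal.span {f}))).presheaf.stalk v) → s ∈ Scheme.regularLocus S') ∧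
        (∀ s : S', CMCl (S'.presheaf.stalk s))) ∧
      (∀ s : S', FullCl 3 (S'.presheaf.stalk s))) := by
  haveI : Fact (Nat.Prime 3) := ⟨Nat.prime_three⟩
  exact ⟨vertex_not_fullCl_quartic_char3 k F hF hcu f hf hprime v hv, vertex_closed_singular_deg k 4 (by norm_num) F hF f hf hprime v hv,
    pointFloor_legal_full_quartic k 3 (by decide) F hF f hf hprime hoff hws v hv⟩

/-- ★ **THE CENSUS PAIR `¬ FullCl 3 (𝒪_{Y,v}) ∧ FInjectivizationGermAt 3 v`** for every member of the class (`char k = 3`). [OURS · unconditional F-side class row] -/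
theorem quartic_bad_germ_row_char3 [CharP k 3] (F : MvPolynomial (Fin 4) k) (hF : F.IsHomogeneous 4) (hcu : ∀ d ∈ F.support, ∃ i, 3 ≤ d i)
    (f : MvPolynomial (Fin 5) k) (hf : f = X 4 ^ 2 + rename (Fin.castSucc : Fin 4 → Fin 5) F) (hprime : Prime f)
    (hoff : ∀ (P : Ideal (MvPolynomial (Fin 5) k ⧸ Ideal.span {f})) [P.IsPrime],
      ¬ Ideal.span (Set.range fun j : Fin 5 => Ideal.Quotient.mk (Ideal.span {f}) (X j)) ≤ P → IsRegularLocalRing (Localization.AtPrime P))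
    (hws : ∀ (a : Fin 4) (Q : Ideal (MvPolynomial (Fin 3) k)), Q.IsPrime →
      MvPolynomial.aeval ((![![1, X 0, X 1, X 2], ![X 0, 1, X 1, X 2], ![X 0, X 1, 1, X 2], ![X 0, X 1, X 2, 1]] : Fin 4 → Fin 4 → MvPolynomial (Fin 3) k) a) F ∈ Q →
      ∃ D : Derivation k (MvPolynomial (Fin 3) k) (MvPolynomial (Fin 3) k),
        D (MvPolynomial.aeval ((![![1, X 0, X 1, X 2], ![X 0, 1, X 1, X 2], ![X 0, X 1, 1, X 2], ![X 0, X 1, X 2, 1]] : Fin 4 → Fin 4 → MvPolynomial (Fin 3) k) a) F) ∉ Q)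
    (v : Spec (.of (MvPolynomial (Fin 5) k ⧸ Ideal.span {f})))
    (hv : v.asIdeal = Ideal.span (Set.range fun j : Fin 5 => Ideal.Quotient.mk (Ideal.span {f}) (X j))) :
    ¬ FullCl 3 ((Spec (.of (MvPolynomial (Fin 5) k ⧸ Ideal.span {f}))).presheaf.stalk v) ∧ FInjectivizationGermAt 3 v := by
  haveI : Fact (Nat.Prime 3) := ⟨Nat.prime_three⟩
  exact ⟨vertex_not_fullCl_quartic_char3 k F hF hcu f hf hprime v hv, fInjectivizationGermAt_quartic k 3 (by decide) F hF f hf hprime hoff hws v hv⟩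

/-! ## §4 The Fermat quartic `z² + x⁴ + y⁴ + u⁴ + t⁴` over any field of characteristic 3 -/

/-- The Fermat quartic form is homogeneous of degree 4. [elementary] -/
theorem fermat4_isHomogeneous : (X 0 ^ 4 + X 1 ^ 4 + X 2 ^ 4 + X 3 ^ 4 : MvPolynomial (Fin 4) k).IsHomogeneous 4 :=
  (((isHomogeneous_X_pow (R := k) (0 : Fin 4) 4).add (isHomogeneous_X_pow (R := k) (1 : Fin 4) 4)).add
    (isHomogeneous_X_pow (R := k) (2 : Fin 4) 4)).add (isHomogeneous_X_pow (R := k) (3 : Fin 4) 4)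

/-- Every monomial of the Fermat quartic contains a cube (indeed a fourth power). [elementary] -/
theorem fermat4_support_cube : ∀ d ∈ (X 0 ^ 4 + X 1 ^ 4 + X 2 ^ 4 + X 3 ^ 4 : MvPolynomial (Fin 4) k).support, ∃ i, 3 ≤ d i := by
  classical
  intro d hd
  simp only [X_pow_eq_monomial] at hd
  rcases Finset.mem_union.mp (support_add hd) with h | h
  · rcases Finset.mem_union.mp (support_add h) with h | h
    · rcases Finset.mem_union.mp (support_add h) with h | h
      · exact ⟨0, by rw [CensusBedsWeaklyNondegenerate.eq_of_mem_support_monomial h]; simp⟩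
      · exact ⟨1, by rw [CensusBedsWeaklyNondegenerate.eq_of_mem_support_monomial h]; simp⟩
    · exact ⟨2, by rw [CensusBedsWeaklyNondegenerate.eq_of_mem_support_monomial h]; simp⟩
  · exact ⟨3, by rw [CensusBedsWeaklyNondegenerate.eq_of_mem_support_monomial h]; simp⟩

/-- `f = X₄² + (ΣY_j⁴)(X₀..X₃)` is `z² + x⁴ + y⁴ + u⁴ + t⁴`. [plumbing] -/
theorem fermat4_f_eq (f : MvPolynomial (Fin 5) k)
    (hf : f = X 4 ^ 2 + rename (Fin.castSucc : Fin 4 → Fin 5) (X 0 ^ 4 + X 1 ^ 4 + X 2 ^ 4 + X 3 ^ 4 : MvPolynomial (Fin 4) k)) :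
    f = X 4 ^ 2 + X 0 ^ 4 + X 1 ^ 4 + X 2 ^ 4 + X 3 ^ 4 := by
  rw [hf]
  simp only [map_add, map_pow, rename_X]
  have e0 : (Fin.castSucc (0 : Fin 4) : Fin 5) = 0 := rfl
  have e1 : (Fin.castSucc (1 : Fin 4) : Fin 5) = 1 := rfl
  have e2 : (Fin.castSucc (2 : Fin 4) : Fin 5) = 2 := rfl
  have e3 : (Fin.castSucc (3 : Fin 4) : Fin 5) = 3 := rfl
  rw [e0, e1, e2, e3]
  ring

/-- ★ **`z² + x⁴ + y⁴ + u⁴ + t⁴` IS PRIME over every field of CHARACTERISTIC 3**: as `T² + C(s)`, `s = x⁴ + y⁴ + u⁴ + t⁴`, Eisenstein-type at `(1, 1, 1, 0)` where `s = 3 = 0` and `∂s/∂x = 4 = 1`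
(✓ `irreducible_X_pow_add_C`). [folklore] -/
theorem prime_fermatQuartic_char3 [CharP k 3] (f : MvPolynomial (Fin 5) k)
    (hf : f = X 4 ^ 2 + rename (Fin.castSucc : Fin 4 → Fin 5) (X 0 ^ 4 + X 1 ^ 4 + X 2 ^ 4 + X 3 ^ 4 : MvPolynomial (Fin 4) k)) : Prime f := by
  have hf' := fermat4_f_eq k f hf
  have h3 : (3 : k) = 0 := by exact_mod_cast CharP.cast_eq_zero k 3
  have h4 : (4 : k) ≠ 0 := by
    intro h; exact one_ne_zero (by linear_combination h - h3 : (1 : k) = 0)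
  set e : MvPolynomial (Fin 5) k ≃+* Polynomial (MvPolynomial (Fin 4) k) :=
    ((renameEquiv k (_root_.finRotate 5)).trans (finSuccEquiv k 4)).toRingEquiv with he_def
  have hrot4 : (_root_.finRotate 5) (4 : Fin 5) = 0 := by decide
  have hrot : ∀ j : Fin 4, (_root_.finRotate 5) (Fin.castSucc j) = j.succ := by decide
  have he4 : e (X 4) = Polynomial.X := by
    show finSuccEquiv k 4 (rename _ (X 4)) = _
    rw [rename_X, hrot4]; exact finSuccEquiv_X_zero
  have hej : ∀ j : Fin 4, e (X (Fin.castSucc j)) = Polynomial.C (X j) := fun j => by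
    show finSuccEquiv k 4 (rename _ (X (Fin.castSucc j))) = _
    rw [rename_X, hrot j]; exact finSuccEquiv_X_succ (j := j)
  set s : MvPolynomial (Fin 4) k := X 0 ^ 4 + X 1 ^ 4 + X 2 ^ 4 + X 3 ^ 4 with hs
  have hef : e f = Polynomial.X ^ 2 + Polynomial.C s := by
    rw [hf', map_add, map_add, map_add, map_add, map_pow, he4, map_pow, map_pow, map_pow, map_pow,
      show (0 : Fin 5) = Fin.castSucc (0 : Fin 4) from rfl, show (1 : Fin 5) = Fin.castSucc (1 : Fin 4) from rfl,
      show (2 : Fin 5) = Fin.castSucc (2 : Fin 4) from rfl, show (3 : Fin 5) = Fin.castSucc (3 : Fin 4) from rfl, hej, hej, hej, hej, hs]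
    simp only [map_add, map_pow]
    ring
  set q : Fin 4 → k := ![1, 1, 1, 0] with hq
  have hsq : MvPolynomial.eval q s = 0 := by
    rw [hs]
    simp only [map_add, map_pow, eval_X, hq, Matrix.cons_val_zero, Matrix.cons_val_one, Matrix.cons_val]
    norm_num
    linear_combination h3
  have hder : MvPolynomial.eval q (pderiv 0 s) ≠ 0 := by
    have e1 : pderiv 0 s = 4 * X 0 ^ 3 := by
      rw [hs]
      simp only [map_add, Derivation.leibniz_pow, pderiv_X_self, pderiv_X_of_ne (show (1 : Fin 4) ≠ 0 by decide),
        pderiv_X_of_ne (show (2 : Fin 4) ≠ 0 by decide), pderiv_X_of_ne (show (3 : Fin 4) ≠ 0 by decide), smul_eq_mul, nsmul_eq_mul]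
      push_cast; ring
    rw [e1, map_mul, map_pow, eval_X, hq]
    simp only [Matrix.cons_val_zero, one_pow, mul_one]
    rw [show (MvPolynomial.eval ![(1 : k), 1, 1, 0]) 4 = (4 : k) from by simp]
    exact h4
  have hirr : Irreducible (e f) := by
    rw [hef]
    exact Literature.AlgebraicGeometry.Motives.SmoothHypersurface.irreducible_X_pow_add_C (d := 2) (by norm_num) s q hsq 0 hder
  exact (MulEquiv.prime_iff e).mp hirr.prime

/-- **The four dehomogenisations of the Fermat quartic are `1 + Z₀⁴ + Z₁⁴ + Z₂⁴`.** [elementary] -/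
theorem dehomogenisation_fermat4 (a : Fin 4) :
    MvPolynomial.aeval ((![![1, X 0, X 1, X 2], ![X 0, 1, X 1, X 2], ![X 0, X 1, 1, X 2], ![X 0, X 1, X 2, 1]] : Fin 4 → Fin 4 → MvPolynomial (Fin 3) k) a)
      (X 0 ^ 4 + X 1 ^ 4 + X 2 ^ 4 + X 3 ^ 4 : MvPolynomial (Fin 4) k) = 1 + X 0 ^ 4 + X 1 ^ 4 + X 2 ^ 4 := by
  fin_cases a <;> simp <;> ring

/-- **`V(1 + Z₀⁴ + Z₁⁴ + Z₂⁴)` is pointwise smooth whenever `4 ≠ 0` in `k`**: at a prime `𝔮 ∋ w` some `Z_b ∉ 𝔮` (else `1 ∈ 𝔮`), and `∂_b w = 4Z_b³ ∉ 𝔮`. [elementary;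
cite: StacksProject, Tag 07PF] -/
theorem smooth_fermat4_chart (h4 : (4 : k) ≠ 0) (Q : Ideal (MvPolynomial (Fin 3) k)) (hQ : Q.IsPrime) (hw : (1 + X 0 ^ 4 + X 1 ^ 4 + X 2 ^ 4 : MvPolynomial (Fin 3) k) ∈ Q) :
    ∃ D : Derivation k (MvPolynomial (Fin 3) k) (MvPolynomial (Fin 3) k), D (1 + X 0 ^ 4 + X 1 ^ 4 + X 2 ^ 4 : MvPolynomial (Fin 3) k) ∉ Q := by
  -- some variable misses `Q`
  have hex : ∃ b : Fin 3, (X b : MvPolynomial (Fin 3) k) ∉ Q := by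
    by_contra hall
    push Not at hall
    apply hQ.ne_top
    rw [Ideal.eq_top_iff_one]
    have e : (1 : MvPolynomial (Fin 3) k) = (1 + X 0 ^ 4 + X 1 ^ 4 + X 2 ^ 4) - (X 0 * X 0 ^ 3 + X 1 * X 1 ^ 3 + X 2 * X 2 ^ 3) := by ring
    rw [e]
    exact sub_mem hw (add_mem (add_mem (Ideal.mul_mem_right _ _ (hall 0)) (Ideal.mul_mem_right _ _ (hall 1))) (Ideal.mul_mem_right _ _ (hall 2)))
  obtain ⟨b, hb⟩ := hex
  refine ⟨pderiv b, ?_⟩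
  have hd : pderiv b (1 + X 0 ^ 4 + X 1 ^ 4 + X 2 ^ 4 : MvPolynomial (Fin 3) k) = C (4 : k) * X b ^ 3 := by
    rw [map_ofNat (C : k →+* MvPolynomial (Fin 3) k) 4]
    obtain rfl | rfl | rfl : b = 0 ∨ b = 1 ∨ b = 2 := by fin_cases b <;> simp
    · simp only [map_add, Derivation.map_one_eq_zero, Derivation.leibniz_pow, pderiv_X_self, smul_eq_mul, nsmul_eq_mul,
        pderiv_X_of_ne (show (1 : Fin 3) ≠ 0 by decide), pderiv_X_of_ne (show (2 : Fin 3) ≠ 0 by decide)]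
      push_cast; ring
    · simp only [map_add, Derivation.map_one_eq_zero, Derivation.leibniz_pow, pderiv_X_self, smul_eq_mul, nsmul_eq_mul,
        pderiv_X_of_ne (show (0 : Fin 3) ≠ 1 by decide), pderiv_X_of_ne (show (2 : Fin 3) ≠ 1 by decide)]
      push_cast; ring
    · simp only [map_add, Derivation.map_one_eq_zero, Derivation.leibniz_pow, pderiv_X_self, smul_eq_mul, nsmul_eq_mul,
        pderiv_X_of_ne (show (0 : Fin 3) ≠ 2 by decide), pderiv_X_of_ne (show (1 : Fin 3) ≠ 2 by decide)]
      push_cast; ring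
  rw [hd]
  have hC : (C (4 : k) : MvPolynomial (Fin 3) k) ∉ Q := fun h =>
    hQ.ne_top ((Ideal.eq_top_iff_one _).mpr (by
      have hu : IsUnit (C (4 : k) : MvPolynomial (Fin 3) k) := (isUnit_iff_ne_zero.mpr h4).map C
      exact (Ideal.unit_mul_mem_iff_mem _ hu).mp (by simpa using h)))
  exact fun h => (hQ.mem_or_mem h).elim hC fun h' => hb (hQ.mem_of_pow_mem 3 h')

/-- ★ **THE FERMAT QUARTIC AT `p = 3`** — for every field `k` of characteristic 3 and `f = X₄² + (ΣY_j⁴)(X₀..X₃)`: the full F-side class row of §3 (vertex not F-pure; scope; point floor LEGAL and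
`FullCl 3` at every stalk) ∧ `FInjectivizationGermAt 3 v`. `hoff` from this seat's ✓ `BrieskornPhamSpecimen.regular_off_vertex` (`c = 2`, `a_j = 4 ≠ 0` in `k`). [OURS · instance] -/
theorem fermatQuartic_fSide_row_char3 [CharP k 3] (f : MvPolynomial (Fin 5) k)
    (hf : f = X 4 ^ 2 + rename (Fin.castSucc : Fin 4 → Fin 5) (X 0 ^ 4 + X 1 ^ 4 + X 2 ^ 4 + X 3 ^ 4 : MvPolynomial (Fin 4) k))
    (v : Spec (.of (MvPolynomial (Fin 5) k ⧸ Ideal.span {f})))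
    (hv : v.asIdeal = Ideal.span (Set.range fun j : Fin 5 => Ideal.Quotient.mk (Ideal.span {f}) (X j))) :
    (¬ FullCl 3 ((Spec (.of (MvPolynomial (Fin 5) k ⧸ Ideal.span {f}))).presheaf.stalk v) ∧
    (IsClosed ({v} : Set (Spec (.of (MvPolynomial (Fin 5) k ⧸ Ideal.span {f})))) ∧
      v ∉ Scheme.regularLocus (Spec (.of (MvPolynomial (Fin 5) k ⧸ Ideal.span {f}))) ∧
      ringKrullDim ((Spec (.of (MvPolynomial (Fin 5) k ⧸ Ideal.span {f}))).presheaf.stalk v) = (4 : ℕ)) ∧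
    (∀ (S' : Scheme.{0}) (g : S' ⟶ Spec ((Spec (.of (MvPolynomial (Fin 5) k ⧸ Ideal.span {f}))).presheaf.stalk v)),
      IsBlowup g ((affineBlowup.idealSheaf (Ideal.span (Set.range (fun j : Fin 5 => Ideal.Quotient.mk (Ideal.span {f}) (X j))))).comap
        ((Spec (.of (MvPolynomial (Fin 5) k ⧸ Ideal.span {f}))).fromSpecStalk v)) →
      (((affineBlowup.idealSheaf (Ideal.span (Set.range (fun j : Fin 5 => Ideal.Quotient.mk (Ideal.span {f}) (X j))))).comap
          ((Spec (.of (MvPolynomial (Fin 5) k ⧸ Ideal.span {f}))).fromSpecStalk v)) ≠ ⊥ ∧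
        (((((affineBlowup.idealSheaf (Ideal.span (Set.range (fun j : Fin 5 => Ideal.Quotient.mk (Ideal.span {f}) (X j))))).comap
            ((Spec (.of (MvPolynomial (Fin 5) k ⧸ Ideal.span {f}))).fromSpecStalk v))).support :
              Set (Spec ((Spec (.of (MvPolynomial (Fin 5) k ⧸ Ideal.span {f}))).presheaf.stalk v))) ⊆
            (Scheme.regularLocus (Spec ((Spec (.of (MvPolynomial (Fin 5) k ⧸ Ideal.span {f}))).presheaf.stalk v)))ᶜ) ∧
        (∀ s : S', g.base s ≠ closedPoint ((Spec (.of (MvPolynomial (Fin 5) k ⧸ Ideal.span {f}))).presheaf.stalk v) → s ∈ Scheme.regularLocus S') ∧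
        (∀ s : S', CMCl (S'.presheaf.stalk s))) ∧
      (∀ s : S', FullCl 3 (S'.presheaf.stalk s)))) ∧
    FInjectivizationGermAt 3 v := by
  have h3 : (3 : k) = 0 := by exact_mod_cast CharP.cast_eq_zero k 3
  have h4 : (4 : k) ≠ 0 := by
    intro h; exact one_ne_zero (by linear_combination h - h3 : (1 : k) = 0)
  have h4' : ((4 : ℕ) : k) ≠ 0 := by exact_mod_cast h4
  have hf' := fermat4_f_eq k f hf
  have hprime := prime_fermatQuartic_char3 k f hf
  have hoff : ∀ (P : Ideal (MvPolynomial (Fin 5) k ⧸ Ideal.span {f})) [P.IsPrime],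
      ¬ Ideal.span (Set.range fun j : Fin 5 => Ideal.Quotient.mk (Ideal.span {f}) (X j)) ≤ P → IsRegularLocalRing (Localization.AtPrime P) :=
    fun P _ hP => BrieskornPhamSpecimen.regular_off_vertex k 2 4 4 4 4 le_rfl (by norm_num) (by norm_num) (by norm_num) (by norm_num) h4' h4' h4' h4' f hf' P hP
  have hws : ∀ (a : Fin 4) (Q : Ideal (MvPolynomial (Fin 3) k)), Q.IsPrime →
      MvPolynomial.aeval ((![![1, X 0, X 1, X 2], ![X 0, 1, X 1, X 2], ![X 0, X 1, 1, X 2], ![X 0, X 1, X 2, 1]] : Fin 4 → Fin 4 → MvPolynomial (Fin 3) k) a)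
        (X 0 ^ 4 + X 1 ^ 4 + X 2 ^ 4 + X 3 ^ 4 : MvPolynomial (Fin 4) k) ∈ Q →
      ∃ D : Derivation k (MvPolynomial (Fin 3) k) (MvPolynomial (Fin 3) k),
        D (MvPolynomial.aeval ((![![1, X 0, X 1, X 2], ![X 0, 1, X 1, X 2], ![X 0, X 1, 1, X 2], ![X 0, X 1, X 2, 1]] : Fin 4 → Fin 4 → MvPolynomial (Fin 3) k) a)
          (X 0 ^ 4 + X 1 ^ 4 + X 2 ^ 4 + X 3 ^ 4 : MvPolynomial (Fin 4) k)) ∉ Q := fun a Q hQ hQa => by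
    rw [dehomogenisation_fermat4] at hQa ⊢
    exact smooth_fermat4_chart k h4 Q hQ hQa
  exact ⟨fSide_classRow_quartic_char3 k _ (fermat4_isHomogeneous k) (fermat4_support_cube k) f hf hprime hoff hws v hv,
    fInjectivizationGermAt_quartic k 3 (by decide) _ (fermat4_isHomogeneous k) f hf hprime hoff hws v hv⟩

/-- **The Fermat quartic at `p = 3`, census pair**: `¬ FullCl 3 (𝒪_{Y,v}) ∧ FInjectivizationGermAt 3 v`. [OURS · instance] -/
theorem fermatQuartic_bad_germ_row_char3 [CharP k 3] (f : MvPolynomial (Fin 5) k)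
    (hf : f = X 4 ^ 2 + rename (Fin.castSucc : Fin 4 → Fin 5) (X 0 ^ 4 + X 1 ^ 4 + X 2 ^ 4 + X 3 ^ 4 : MvPolynomial (Fin 4) k))
    (v : Spec (.of (MvPolynomial (Fin 5) k ⧸ Ideal.span {f})))
    (hv : v.asIdeal = Ideal.span (Set.range fun j : Fin 5 => Ideal.Quotient.mk (Ideal.span {f}) (X j))) :
    ¬ FullCl 3 ((Spec (.of (MvPolynomial (Fin 5) k ⧸ Ideal.span {f}))).presheaf.stalk v) ∧ FInjectivizationGermAt 3 v :=
  ⟨(fermatQuartic_fSide_row_char3 k f hf v hv).1.1, (fermatQuartic_fSide_row_char3 k f hf v hv).2⟩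

end Summit.ResolutionOfSingularities.ResolutionOfSingularities.Theorems.FInjectiveMacaulayfication.X2QuarticFSideChar3

end
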